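import Literature.Barriers.CriticalPhenomena.WeaklySAWSojournSimplex
import Mathlib.Analysis.SpecialFunctions.ImproperIntegrals
import Mathlib.Analysis.SpecialFunctions.Pow.Asymptotics
import Mathlib.MeasureTheory.Integral.ExpDecay
import Mathlib.Algebra.Order.Chebyshev
import HarnessLib

/-!
# The continuous-time weakly self-avoiding walk: exponential decay of `c_T`, `χ(g,-ν_c) < ∞`,
# and the refutation of the literal transcription `BBS2015_cesaro`

Companion to `WeaklySAWFourDimLogCorrections.lean` (definitions; namespace
`Literature.Barriers.CriticalPhenomena.CTWSAW`) and to `WeaklySAWFourDimLogCorrectionsProofs.lean` /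
`WeaklySAWSojournSimplex.lean` (the sojourn simplex, its volume `T^k/k!`, walk counting, `c_T ≤ 1`,
`χ` antitone, `ν_c ≤ 0`), whose lemmas are reused here. Source: Bauerschmidt–Brydges–Slade 2015,
CMP 337, arXiv:1403.7422, §1.1 and §1.3. Everything in this file is a THEOREM (no definitions, no
named facts):

* the Cauchy–Schwarz bound `I(T) ≥ T²/(k+1)` for a trajectory with `k` jumps
  (`sq_div_le_selfIntersection`), whence the jump-chain bound
  `c_T ≤ e^{-2dT} Σ_k (2dT)^k/k! · e^{-gT²/(k+1)}` (`survival_le_tsum`) and, by AM–GM in the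
  exponent, the exponential decay `c_T ≤ e^{g/(4d²)} e^{-(g/(2d) - g²/(8d³)) T}` for `0 < g ≤ 4d²`
  (`survival_le_exp`);
* hence `χ(g,ν) < ∞` for some `ν < 0` (`exists_neg_susceptibility_lt_top`) and
  `∫₀^∞ c_T e^{ν_c T} dT = χ(g,-ν_c) < ∞` (`susceptibility_neg_criticalNu_lt_top`; in print
  "`ν_c(g) < 0` for `g > 0`", §1.3, first paragraph);
* consequently the literal transcription `BBS2015_cesaro` of the first display of §1.3 — which
  carries `e^{+ν_c S}` where the paper's own (1.3) forces `e^{-ν_c S}`, see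
  `WeaklySAWFourDimLogCorrectionsCesaro.lean` — is FALSE: its numerator stays bounded while the
  denominator `T · A (log T)^{1/4} → ∞` (`not_BBS2015_cesaro`). The corrected statement
  `BBS2015_cesaro_corrected` is derived from Theorem 1.1 in
  `WeaklySAWFourDimLogCorrectionsCesaroProofs.lean`. Likewise the literal
  `BBS2015_pointwise_prediction` (`c_T ∼ A e^{-ν_c T}(log T)^{1/4}` as printed) is false already
  from `c_T ≤ 1` and `ν_c ≤ 0` (`not_BBS2015_pointwise_prediction`); the intended prediction is
  `BBS2015_pointwise_prediction_corrected`, open as in print. Both literal transcriptions are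
  `@[deprecated]` in `WeaklySAWFourDimLogCorrections.lean` (2026-08-15, mis-stated); the two
  refutations below must nevertheless NAME them (that is their content), so each carries
  `set_option linter.deprecated false in` — the only references to the deprecated names in the tree.

The decay rate here is crude (in print the sharp statement is Theorem 1.2,
`ν_c(g) = -2C₀(0)g + O(g²)`); it only serves finiteness of `χ` slightly below `0`.

## References

* R. Bauerschmidt, D. C. Brydges, G. Slade, CMP 337 (2015) 817–877, arXiv:1403.7422, §1.1
  ((1.1)–(1.4)), §1.3 (first paragraph and the Cesàro display), Appendix A, Lemma A.1.
  [cite: BauerschmidtBrydgesSlade2015LogCorr]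
-/

noncomputable section

open MeasureTheory Filter Topology Set Literature.Probability.LatticeModels
open scoped ENNReal BigOperators Nat

namespace Literature.Barriers.CriticalPhenomena

namespace CTWSAW

variable {d : ℕ}

/-! ### The self-intersection local time of a `k`-jump trajectory is at least `T²/(k+1)` -/

/-- Cauchy–Schwarz: `I = Σ_{i,j} 𝟙{ω(i)=ω(j)} σᵢσⱼ ≥ Σᵢ σᵢ² ≥ (Σᵢ σᵢ)²/(k+1) = T²/(k+1)` on the
sojourn set. [cite: BauerschmidtBrydgesSlade2015LogCorr, §1.1 (1.1)] -/
theorem sq_div_le_selfIntersection {T : ℝ} {x : Site d} (ω : (zdGraph d).Walk 0 x)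
    {s : Fin ω.length → ℝ} (hs : s ∈ sojournSet ω.length T) :
    T ^ 2 / (ω.length + 1) ≤ selfIntersection T ω s := by
  have hpos := sojourns_pos hs
  have h1 : ∑ i : Fin (ω.length + 1), sojourns T s i ^ 2 ≤ selfIntersection T ω s := by
    unfold selfIntersection
    refine Finset.sum_le_sum fun i _ => ?_
    have : sojourns T s i ^ 2 =
        (if ω.getVert i = ω.getVert i then sojourns T s i * sojourns T s i else 0) := by
      rw [if_pos rfl, sq]
    rw [this]
    refine Finset.single_le_sum (f := fun j : Fin (ω.length + 1) =>
      if ω.getVert i = ω.getVert j then sojourns T s i * sojourns T s j else 0)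
      (fun j _ => ?_) (Finset.mem_univ i)
    show (0 : ℝ) ≤ (if ω.getVert i = ω.getVert j then sojourns T s i * sojourns T s j else 0)
    split_ifs
    · exact mul_nonneg (hpos i).le (hpos j).le
    · exact le_rfl
  have h2 := sq_sum_le_card_mul_sum_sq (s := (Finset.univ : Finset (Fin (ω.length + 1))))
    (f := fun i => sojourns T s i)
  rw [sum_sojourns, Finset.card_univ, Fintype.card_fin] at h2
  push_cast at h2
  rw [div_le_iff₀ (by positivity)]
  nlinarith

/-! ### Bounds on `c_T` -/

/-- The simplex volume `T^k/k!` (`volume_sojournSet`) as an inequality valid for all `T`. [folklore] -/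
theorem volume_sojournSet_le (k : ℕ) (T : ℝ) :
    volume (sojournSet k T) ≤ ENNReal.ofReal (T ^ k / k !) := by
  rw [volume_sojournSet]
  split_ifs
  · exact le_rfl
  · exact bot_le

/-- `∫ e^{-gI} ds ≤ e^{-gT²/(k+1)} · T^k/k!` for a `k`-step skeleton, `g ≥ 0` (for `T ≤ 0` the
left side vanishes).
[cite: BauerschmidtBrydgesSlade2015LogCorr, §1.1] -/
theorem pathIntegral_le {g : ℝ} (hg : 0 ≤ g) (T : ℝ) {x : Site d}
    (ω : (zdGraph d).Walk 0 x) :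
    pathIntegral g T ω ≤ ENNReal.ofReal (Real.exp (-(g * T ^ 2 / (ω.length + 1)))) *
      ENNReal.ofReal (T ^ ω.length / (ω.length)!) := by
  unfold pathIntegral
  calc ∫⁻ s in sojournSet ω.length T, ENNReal.ofReal (Real.exp (-g * selfIntersection T ω s))
      ≤ ∫⁻ _s in sojournSet ω.length T, ENNReal.ofReal (Real.exp (-(g * T ^ 2 / (ω.length + 1)))) := by
        refine setLIntegral_mono' (measurableSet_sojournSet _ _) fun s hs => ?_
        refine ENNReal.ofReal_le_ofReal (Real.exp_le_exp.mpr ?_)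
        have h1 := mul_le_mul_of_nonneg_left (sq_div_le_selfIntersection ω hs) hg
        have h2 : g * (T ^ 2 / (ω.length + 1)) = g * T ^ 2 / (ω.length + 1) := by ring
        rw [neg_mul, neg_le_neg_iff, ← h2]
        exact h1
    _ = ENNReal.ofReal (Real.exp (-(g * T ^ 2 / (ω.length + 1)))) * volume (sojournSet ω.length T) :=
        setLIntegral_const _ _
    _ ≤ _ := mul_le_mul' le_rfl (volume_sojournSet_le _ T)

/-- `Σ_k y^k/k! = e^y` in `ℝ≥0∞`, for `y ≥ 0`. [folklore] -/
theorem tsum_ofReal_pow_div_factorial {y : ℝ} (hy : 0 ≤ y) :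
    ∑' k : ℕ, ENNReal.ofReal (y ^ k / k !) = ENNReal.ofReal (Real.exp y) := by
  rw [Real.exp_eq_exp_ℝ, congr_fun NormedSpace.exp_eq_tsum_div y]
  exact (ENNReal.ofReal_tsum_of_nonneg (fun k => by positivity)
    (Real.summable_pow_div_factorial y)).symm

/-- The jump-chain bound on `c_T`: `c_T ≤ e^{-2dT} Σ_k (2dT)^k/k! · e^{-gT²/(k+1)}` (`g ≥ 0`).
[cite: BauerschmidtBrydgesSlade2015LogCorr, §1.1] -/
theorem survival_le_tsum (d : ℕ) {g : ℝ} (hg : 0 ≤ g) (T : ℝ) :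
    survival d g T ≤ ENNReal.ofReal (Real.exp (-(2 * d) * T)) *
      ∑' k : ℕ, ENNReal.ofReal ((2 * d * T) ^ k / k !) *
        ENNReal.ofReal (Real.exp (-(g * T ^ 2 / (k + 1)))) := by
  unfold survival weightedExpectation
  refine mul_le_mul' le_rfl (ENNReal.tsum_le_tsum fun k => ?_)
  -- bound each skeleton's integral, then count skeletons
  set B : ℝ≥0∞ := ENNReal.ofReal (Real.exp (-(g * T ^ 2 / (k + 1)))) *
    ENNReal.ofReal (T ^ k / k !) with hB
  calc ∑ x ∈ box d k, ∑ ω ∈ (zdGraph d).finsetWalkLength k (0 : Site d) x, 1 * pathIntegral g T ω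
      ≤ ∑ x ∈ box d k, ∑ _ω ∈ (zdGraph d).finsetWalkLength k (0 : Site d) x, B := by
        refine Finset.sum_le_sum fun x _ => Finset.sum_le_sum fun ω hω => ?_
        rw [SimpleGraph.mem_finsetWalkLength_iff] at hω
        rw [one_mul, hB, ← hω]
        have := pathIntegral_le hg T ω
        exact_mod_cast this
    _ = (∑ x ∈ box d k, (((zdGraph d).finsetWalkLength k (0 : Site d) x).card : ℝ≥0∞)) * B := by
        rw [Finset.sum_mul]
        refine Finset.sum_congr rfl fun x _ => ?_
        rw [Finset.sum_const, nsmul_eq_mul]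
    _ ≤ (((2 * d) ^ k : ℕ) : ℝ≥0∞) * B := by
        gcongr
        exact_mod_cast sum_card_finsetWalkLength_zdGraph_le d k 0 (box d k)
    _ = ENNReal.ofReal ((2 * d * T) ^ k / k !) * ENNReal.ofReal (Real.exp (-(g * T ^ 2 / (k + 1)))) := by
        have hN : (((2 * d) ^ k : ℕ) : ℝ≥0∞) = ENNReal.ofReal (((2 * d) ^ k : ℕ) : ℝ) :=
          (ENNReal.ofReal_natCast _).symm
        rw [hN, hB, show ((2 : ℝ) * d * T) ^ k / k ! = (((2 * d) ^ k : ℕ) : ℝ) * (T ^ k / k !) by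
          push_cast; ring, ENNReal.ofReal_mul (by positivity)]
        ring

/-- AM–GM in the exponent: `-gT²/(k+1) ≤ a²(k+1)/g - 2aT`. [folklore] -/
theorem neg_sq_div_le {g : ℝ} (hg : 0 < g) (a T : ℝ) (k : ℕ) :
    -(g * T ^ 2 / (k + 1)) ≤ a ^ 2 * (k + 1) / g - 2 * a * T := by
  have hk : (0 : ℝ) < k + 1 := by positivity
  have key : 0 ≤ (g * T - a * (k + 1)) ^ 2 / (g * (k + 1)) := by positivity
  have : (g * T - a * (k + 1)) ^ 2 / (g * (k + 1)) =
      g * T ^ 2 / (k + 1) + a ^ 2 * (k + 1) / g - 2 * a * T := by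
    field_simp
    ring
  linarith

/-- **Exponential decay of `c_T`**: for `0 < g ≤ 4d²` and `T ≥ 0`,
`c_T ≤ exp(g/(4d²)) · exp(-(g/(2d) - g²/(8d³)) T)`. (From `survival_le_tsum`, the AM–GM bound
`e^{-gT²/(k+1)} ≤ e^{a²(k+1)/g} e^{-2aT}` with `a = g/(2d)`, `Σ_k (2dTe^{a²/g})^k/k! = exp(2dTe^{a²/g})`
and `e^{x} ≤ 1 + x + x²` for `0 ≤ x ≤ 1`.) In print the sharp rate is `ν_c(g) = -2C₀(0)g + O(g²)`
(Theorem 1.2); this crude bound only serves `ν_c < 0`.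
[cite: BauerschmidtBrydgesSlade2015LogCorr, §1.3 (ν_c(g) < 0) and Lemma A.1] -/
theorem survival_le_exp {d : ℕ} (hd : 0 < d) {g : ℝ} (hg : 0 < g) (hg4 : g ≤ 4 * (d : ℝ) ^ 2)
    {T : ℝ} (hT : 0 ≤ T) :
    survival d g T ≤ ENNReal.ofReal (Real.exp (g / (4 * (d : ℝ) ^ 2)) *
      Real.exp (-((g / (2 * d) - g ^ 2 / (8 * (d : ℝ) ^ 3)) * T))) := by
  have hd0 : (0 : ℝ) < d := Nat.cast_pos.mpr hd
  set a : ℝ := g / (2 * d) with ha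
  set c : ℝ := a ^ 2 / g with hc
  have hc' : c = g / (4 * (d : ℝ) ^ 2) := by
    rw [hc, ha]; field_simp; ring
  have hc0 : 0 ≤ c := by positivity
  have hc1 : c ≤ 1 := by
    rw [hc', div_le_one (by positivity)]
    exact hg4
  set y : ℝ := 2 * d * T * Real.exp c with hy
  have hy0 : 0 ≤ y := by positivity
  refine (survival_le_tsum d hg.le T).trans ?_
  -- termwise AM–GM
  have hterm : ∀ k : ℕ, ENNReal.ofReal ((2 * d * T) ^ k / k !) *
      ENNReal.ofReal (Real.exp (-(g * T ^ 2 / (k + 1)))) ≤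
      ENNReal.ofReal (Real.exp (c - 2 * a * T)) * ENNReal.ofReal (y ^ k / k !) := by
    intro k
    rw [← ENNReal.ofReal_mul (by positivity), ← ENNReal.ofReal_mul (Real.exp_pos _).le]
    refine ENNReal.ofReal_le_ofReal ?_
    have h1 : Real.exp (-(g * T ^ 2 / (k + 1))) ≤ Real.exp (c * (k + 1) - 2 * a * T) := by
      refine Real.exp_le_exp.mpr ?_
      have := neg_sq_div_le hg a T k
      rw [hc]
      convert this using 2
      ring
    have h2 : Real.exp (c * (k + 1) - 2 * a * T) = Real.exp (c - 2 * a * T) * Real.exp c ^ k := by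
      rw [← Real.exp_nat_mul, ← Real.exp_add]
      congr 1; ring
    calc (2 * d * T) ^ k / k ! * Real.exp (-(g * T ^ 2 / (k + 1)))
        ≤ (2 * d * T) ^ k / k ! * Real.exp (c * (k + 1) - 2 * a * T) :=
          mul_le_mul_of_nonneg_left h1 (by positivity)
      _ = Real.exp (c - 2 * a * T) * (y ^ k / k !) := by
          rw [h2, hy, mul_pow]; ring
  calc ENNReal.ofReal (Real.exp (-(2 * d) * T)) *
        ∑' k : ℕ, ENNReal.ofReal ((2 * d * T) ^ k / k !) * ENNReal.ofReal (Real.exp (-(g * T ^ 2 / (k + 1))))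
      ≤ ENNReal.ofReal (Real.exp (-(2 * d) * T)) *
          ∑' k : ℕ, ENNReal.ofReal (Real.exp (c - 2 * a * T)) * ENNReal.ofReal (y ^ k / k !) :=
        mul_le_mul' le_rfl (ENNReal.tsum_le_tsum hterm)
    _ = ENNReal.ofReal (Real.exp (-(2 * d) * T) * Real.exp (c - 2 * a * T) * Real.exp y) := by
        rw [ENNReal.tsum_mul_left, tsum_ofReal_pow_div_factorial hy0,
          ENNReal.ofReal_mul (by positivity), ENNReal.ofReal_mul (by positivity)]
        ring
    _ ≤ _ := by
        refine ENNReal.ofReal_le_ofReal ?_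
        rw [← Real.exp_add, ← Real.exp_add, ← Real.exp_add]
        refine Real.exp_le_exp.mpr ?_
        -- `e^c ≤ 1 + c + c²`
        have hexp : Real.exp c ≤ 1 + c + c ^ 2 := by
          have := Real.abs_exp_sub_one_sub_id_le (x := c) (by rw [abs_of_nonneg hc0]; exact hc1)
          rw [abs_le] at this
          linarith [this.2]
        have hyb : y ≤ 2 * d * T * (1 + c + c ^ 2) := by
          rw [hy]; exact mul_le_mul_of_nonneg_left hexp (by positivity)
        have hrate : -(2 * d) * T + (c - 2 * a * T) + 2 * d * T * (1 + c + c ^ 2) =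
            c + -((g / (2 * d) - g ^ 2 / (8 * (d : ℝ) ^ 3)) * T) := by
          rw [hc', ha]; field_simp; ring
        linarith

/-! ### The susceptibility and the critical value -/

/-- `∫₀^∞ e^{-bT} dT < ∞` in `ℝ≥0∞`, for `b > 0`. [folklore] -/
theorem lintegral_exp_neg_lt_top {b : ℝ} (hb : 0 < b) :
    ∫⁻ T in Ioi (0 : ℝ), ENNReal.ofReal (Real.exp (-(b * T))) < ∞ := by
  have hint : IntegrableOn (fun T : ℝ => Real.exp (-(b * T))) (Ioi 0) := by
    simpa only [neg_mul] using exp_neg_integrableOn_Ioi 0 hb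
  rw [← ofReal_integral_eq_lintegral_ofReal hint (ae_of_all _ fun T => (Real.exp_pos _).le)]
  exact ENNReal.ofReal_lt_top

/-- **`χ(g,ν) < ∞` for some `ν < 0`** (`d ≥ 1`, `0 < g ≤ 4d²`): with the decay rate
`δ = g/(2d) - g²/(8d³) > 0` of `survival_le_exp`, any `ν > -δ` works; we take `ν = -δ/2`.
[cite: BauerschmidtBrydgesSlade2015LogCorr, §1.3 (ν_c(g) < 0) and Lemma A.1] -/
theorem exists_neg_susceptibility_lt_top {d : ℕ} (hd : 0 < d) {g : ℝ} (hg : 0 < g)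
    (hg4 : g < 4 * (d : ℝ) ^ 2) :
    ∃ ν : ℝ, ν < 0 ∧ susceptibility d g ν < ∞ := by
  have hd0 : (0 : ℝ) < d := Nat.cast_pos.mpr hd
  set δ : ℝ := g / (2 * d) - g ^ 2 / (8 * (d : ℝ) ^ 3) with hδ
  have hδ0 : 0 < δ := by
    rw [hδ]
    have : g ^ 2 / (8 * (d : ℝ) ^ 3) < g / (2 * d) := by
      rw [div_lt_div_iff₀ (by positivity) (by positivity)]
      have h1 : g * (4 * (d : ℝ) ^ 2) > g * g := by nlinarith [hg4]
      nlinarith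
    linarith
  refine ⟨-(δ / 2), by linarith, ?_⟩
  set C : ℝ := Real.exp (g / (4 * (d : ℝ) ^ 2)) with hC
  unfold susceptibility
  calc ∫⁻ T in Ioi (0 : ℝ), survival d g T * ENNReal.ofReal (Real.exp (-(-(δ / 2)) * T))
      ≤ ∫⁻ T in Ioi (0 : ℝ), ENNReal.ofReal C * ENNReal.ofReal (Real.exp (-(δ / 2 * T))) := by
        refine setLIntegral_mono' measurableSet_Ioi fun T hT => ?_
        have hT0 : 0 ≤ T := le_of_lt hT
        calc survival d g T * ENNReal.ofReal (Real.exp (-(-(δ / 2)) * T))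
            ≤ ENNReal.ofReal (C * Real.exp (-(δ * T))) * ENNReal.ofReal (Real.exp (-(-(δ / 2)) * T)) :=
              mul_le_mul' (by simpa [hC, hδ, neg_mul] using survival_le_exp hd hg hg4.le hT0) le_rfl
          _ = ENNReal.ofReal C * ENNReal.ofReal (Real.exp (-(δ / 2 * T))) := by
              rw [ENNReal.ofReal_mul (Real.exp_pos _).le, mul_assoc,
                ← ENNReal.ofReal_mul (Real.exp_pos _).le, ← Real.exp_add]
              congr 3
              ring
    _ = ENNReal.ofReal C * ∫⁻ T in Ioi (0 : ℝ), ENNReal.ofReal (Real.exp (-(δ / 2 * T))) :=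
        lintegral_const_mul _ (by fun_prop)
    _ < ∞ := ENNReal.mul_lt_top ENNReal.ofReal_lt_top (lintegral_exp_neg_lt_top (by positivity))

/-- If `χ(g,ν₀) < ∞` for some `ν₀ < 0` then `ν₀ ≤ -ν_c` (whether or not the defining infimum is
attained or bounded below: an unbounded-below set has `sInf = 0` in Mathlib). [folklore] -/
theorem le_neg_criticalNu_of_lt_top (d : ℕ) (g : ℝ) {ν₀ : ℝ} (hν₀ : ν₀ < 0)
    (hfin : susceptibility d g ν₀ < ∞) : ν₀ ≤ -criticalNu d g := by
  unfold criticalNu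
  by_cases hbdd : BddBelow {ν : ℝ | susceptibility d g ν < ∞}
  · have := csInf_le hbdd (show ν₀ ∈ {ν : ℝ | susceptibility d g ν < ∞} from hfin)
    linarith
  · rw [Real.sInf_of_not_bddBelow hbdd]
    linarith

/-- **`∫₀^∞ c_T e^{ν_c T} dT = χ(g, -ν_c) < ∞`** for `d ≥ 1` and `0 < g < 4d²`.
[cite: BauerschmidtBrydgesSlade2015LogCorr, §1.3 (ν_c(g) < 0) and Lemma A.1] -/
theorem susceptibility_neg_criticalNu_lt_top {d : ℕ} (hd : 0 < d) {g : ℝ} (hg : 0 < g)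
    (hg4 : g < 4 * (d : ℝ) ^ 2) : susceptibility d g (-criticalNu d g) < ∞ := by
  obtain ⟨ν₀, hν₀, hfin⟩ := exists_neg_susceptibility_lt_top hd hg hg4
  exact (susceptibility_antitone d g (le_neg_criticalNu_of_lt_top d g hν₀ hfin)).trans_lt hfin

/-! ### The literal transcription `BBS2015_cesaro` is false -/

/-- The numerator of `BBS2015_cesaro` is bounded: `∫₀ᵀ c_S e^{ν_c S} dS ≤ χ(g, -ν_c)` for all `T`.
[folklore] -/
theorem lintegral_Ioc_le_susceptibility (d : ℕ) (g T : ℝ) :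
    ∫⁻ S in Ioc 0 T, survival d g S * ENNReal.ofReal (Real.exp (criticalNu d g * S)) ≤
      susceptibility d g (-criticalNu d g) := by
  unfold susceptibility
  simp only [neg_neg]
  exact lintegral_mono_set Ioc_subset_Ioi_self

-- `BBS2015_cesaro` is `@[deprecated]` (mis-stated, 2026-08-15) and its refutation must name it;
-- REMOVE-WHEN the deprecated def is deleted.
set_option linter.deprecated false in
/-- **Refutation of the literal transcription.** `BBS2015_cesaro` (the first display of BBS 2015
§1.3 with `e^{+ν_c S}`, as printed) is false: for every small `g > 0` its numerator
`∫₀ᵀ c_S e^{ν_c S} dS` is bounded by `χ(g,-ν_c) < ∞` (`susceptibility_neg_criticalNu_lt_top`),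
while the denominator `T · A (log T)^{1/4}` tends to `∞`, so the ratio tends to `0`, not `1`. The
statement the paper actually derives (with `e^{-ν_c S}`) is `BBS2015_cesaro_corrected`
(`WeaklySAWFourDimLogCorrectionsCesaro.lean`).
[cite: BauerschmidtBrydgesSlade2015LogCorr, §1.3 (Cesàro display) versus §1.1 (1.3) and ν_c < 0] -/
theorem not_BBS2015_cesaro : ¬ BBS2015_cesaro := by
  rintro ⟨g₀, hg₀, h⟩
  -- a small admissible coupling
  set g : ℝ := min (g₀ / 2) 1 with hg
  have hg0 : 0 < g := lt_min (by linarith) one_pos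
  have hgg₀ : g < g₀ := (min_le_left _ _).trans_lt (by linarith)
  have hg1 : g ≤ 1 := min_le_right _ _
  obtain ⟨A, hA, hT⟩ := h g hg0 hgg₀
  -- the numerator is bounded by `M < ∞`
  have hfin := susceptibility_neg_criticalNu_lt_top (d := 4) (by norm_num) hg0 (by norm_num; linarith)
  set M : ℝ := (susceptibility 4 g (-criticalNu 4 g)).toReal with hM
  have hnum : ∀ T : ℝ, (∫⁻ S in Ioc 0 T,
      survival 4 g S * ENNReal.ofReal (Real.exp (criticalNu 4 g * S))).toReal ≤ M := fun T =>
    ENNReal.toReal_mono hfin.ne (lintegral_Ioc_le_susceptibility 4 g T)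
  -- the denominator tends to infinity
  have hden : Tendsto (fun T : ℝ => T * (A * Real.log T ^ (1 / 4 : ℝ))) atTop atTop := by
    have h1 : Tendsto (fun T : ℝ => Real.log T ^ (1 / 4 : ℝ)) atTop atTop :=
      (tendsto_rpow_atTop (by norm_num)).comp Real.tendsto_log_atTop
    exact Tendsto.atTop_mul_atTop₀ tendsto_id (h1.const_mul_atTop hA)
  -- hence the ratio tends to `0`
  have hzero : Tendsto (fun T : ℝ => (∫⁻ S in Ioc 0 T,
      survival 4 g S * ENNReal.ofReal (Real.exp (criticalNu 4 g * S))).toReal /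
        (T * (A * Real.log T ^ (1 / 4 : ℝ)))) atTop (𝓝 0) := by
    refine squeeze_zero' ?_ ?_ (tendsto_const_nhds.div_atTop hden : Tendsto (fun T => M / _) _ _)
    · filter_upwards [hden.eventually_gt_atTop 0] with T hT
      exact div_nonneg ENNReal.toReal_nonneg hT.le
    · filter_upwards [hden.eventually_gt_atTop 0] with T hT
      exact div_le_div_of_nonneg_right (hnum T) hT.le
  have := tendsto_nhds_unique hT hzero
  norm_num at this

-- `BBS2015_pointwise_prediction` is `@[deprecated]` (mis-stated, 2026-08-15) and its refutation must
-- name it; REMOVE-WHEN the deprecated def is deleted.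
set_option linter.deprecated false in
/-- **Refutation of the second literal transcription.** `BBS2015_pointwise_prediction` (the
believed pointwise display of BBS 2015 §1.3 as printed, `c_T ∼ A e^{-ν_c T}(log T)^{1/4}`) is
false as a statement about the objects of `WeaklySAWFourDimLogCorrections.lean`, whatever the
status of the prediction it transcribes: `c_T ≤ 1` (`survival_le_one`) and `ν_c ≤ 0`
(`criticalNu_le_zero`) give `c_T/(A e^{-ν_c T}(log T)^{1/4}) ≤ 1/(A (log T)^{1/4}) → 0`, not `1`.
The intended (sign-corrected) prediction is `BBS2015_pointwise_prediction_corrected`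
(`WeaklySAWFourDimLogCorrectionsCesaro.lean`), which remains open as in print.
[cite: BauerschmidtBrydgesSlade2015LogCorr, §1.3 (pointwise display) versus §1.1 (1.3) and ν_c ≤ 0] -/
theorem not_BBS2015_pointwise_prediction : ¬ BBS2015_pointwise_prediction := by
  rintro ⟨g₀, hg₀, h⟩
  obtain ⟨A, hA, hT⟩ := h (g₀ / 2) (by positivity) (by linarith)
  set g : ℝ := g₀ / 2 with hg
  have hg0 : 0 ≤ g := by positivity
  have hνc : criticalNu 4 g ≤ 0 := criticalNu_le_zero hg0 4
  -- the denominator tends to infinity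
  have hden0 : Tendsto (fun T : ℝ => A * Real.log T ^ (1 / 4 : ℝ)) atTop atTop :=
    ((tendsto_rpow_atTop (by norm_num)).comp Real.tendsto_log_atTop).const_mul_atTop hA
  have hden : Tendsto (fun T : ℝ =>
      A * Real.exp (-criticalNu 4 g * T) * Real.log T ^ (1 / 4 : ℝ)) atTop atTop := by
    refine tendsto_atTop_mono' atTop ?_ hden0
    filter_upwards [eventually_ge_atTop 1] with T hT
    have hlog : 0 ≤ Real.log T ^ (1 / 4 : ℝ) := Real.rpow_nonneg (Real.log_nonneg hT) _
    have hexp : 1 ≤ Real.exp (-criticalNu 4 g * T) := Real.one_le_exp_iff.mpr (by nlinarith)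
    calc A * Real.log T ^ (1 / 4 : ℝ) = A * 1 * Real.log T ^ (1 / 4 : ℝ) := by rw [mul_one]
      _ ≤ A * Real.exp (-criticalNu 4 g * T) * Real.log T ^ (1 / 4 : ℝ) := by gcongr
  -- the numerator is at most `1`
  have hnum : ∀ T : ℝ, 0 < T → (survival 4 g T).toReal ≤ 1 := fun T hT => by
    have := ENNReal.toReal_mono ENNReal.one_ne_top (survival_le_one hg0 4 hT)
    simpa using this
  -- hence the ratio tends to `0`
  have hzero : Tendsto (fun T : ℝ => (survival 4 g T).toReal /
      (A * Real.exp (-criticalNu 4 g * T) * Real.log T ^ (1 / 4 : ℝ))) atTop (𝓝 0) := by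
    have hlim : Tendsto (fun T : ℝ => (1 : ℝ) /
        (A * Real.exp (-criticalNu 4 g * T) * Real.log T ^ (1 / 4 : ℝ))) atTop (𝓝 0) :=
      tendsto_const_nhds.div_atTop hden
    refine squeeze_zero' ?_ ?_ hlim
    · filter_upwards [hden.eventually_gt_atTop 0] with T hT
      exact div_nonneg ENNReal.toReal_nonneg hT.le
    · filter_upwards [hden.eventually_gt_atTop 0, eventually_gt_atTop 0] with T hT hT0
      exact div_le_div_of_nonneg_right (hnum T hT0) hT.le
  have := tendsto_nhds_unique hT hzero
  norm_num at this

end CTWSAW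

end Literature.Barriers.CriticalPhenomena
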